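import Summits.Ventures.HodgeRepro2.T5SU11SphericalTransform

/-!
# The spherical transform on `C_c(K∖G)`: the eigenfunction property for every parameter `λ ∈ ℝ`

`T5SU11SphericalTransform` proved `∫_G f(h) φ_λ(h⁻¹ g) dμ = f̂(λ) φ_λ(g)` for integrable
left-`K`-invariant `f` and `0 ≤ λ ≤ 2`, where `φ_λ` is bounded. The argument only needs the product
integrability of `(k, h) ↦ f(h) φ_λ(h⁻¹ k⁻¹ g)` on `K × G` (`integral_mul_sph_inv_mul_of_integrable`:
the same proof with that hypothesis abstracted), and for a **continuous compactly supported**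
left-`K`-invariant `f` this holds for **every `λ ∈ ℝ`**: the continuous function
`(k, h) ↦ φ_λ(h⁻¹ k⁻¹ g)` is bounded on the compact `K × tsupport f` (`exists_bound_sph_on_support`),
so the integrand is dominated by `C |f(h)|`. Hence
**`∫_G f(h) φ_λ(h⁻¹ g) dμ(h) = (∫_G f φ_λ dμ) · φ_λ(g)` for all `λ ∈ ℝ`, `f ∈ C_c(G)` left-`K`-invariant**
(`integral_mul_sph_inv_mul_of_hasCompactSupport`): the spherical transform `f ↦ f̂(λ)` on
`C_c(K∖G/K)` is the eigenvalue map of the convolution action on the spherical functions, for every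
parameter. Nothing is claimed about (N).

Blind lane: Mathlib + the HodgeRepro2 prefix only; no sorry; axioms ⊆ {propext, Classical.choice,
Quot.sound}.
-/

namespace Summit.Ventures.HodgeRepro2.T5SU11SphericalTransformCc

open MeasureTheory MeasureTheory.Measure Metric Set Filter Topology Complex
open T5SU11Unimodular T5SU11Fibration T5SU11Cartan T5SU11OneParameter T5SU11CartanProjection
  T5HaarCircle T5BergmanCoefficient T5SU11SphericalFunction T5SU11SphericalTwo
  T5SU11SphericalSymmetry T5SU11SphericalBounds T5SU11SphericalContinuous
  T5SU11SphericalAsymptotic T5SU11SphericalLp T5SU11SphericalCfun T5SU11SphericalLpSharp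
  T5SU11SphericalXiLog T5SU11SphericalCfunLimit T5SU11SphericalStrict T5SU11SphericalProduct
  T5SU11SphericalTransform
open scoped Real

section measure

variable [MeasurableSpace Circle] [BorelSpace Circle]

/-- **The eigenfunction identity under a product-integrability hypothesis** (every `λ ∈ ℝ`): for a
Haar measure `μ` and a left-`K`-invariant `f` with `(k, h) ↦ f(h) φ_λ(h⁻¹ k⁻¹ g)` integrable on
`K × G`, `∫_G f(h) φ_λ(h⁻¹ g) dμ = (∫_G f φ_λ dμ) · φ_λ(g)`. -/
theorem integral_mul_sph_inv_mul_of_integrable (μ : Measure SU11) [IsHaarMeasure μ] (lam : ℝ)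
    {f : SU11 → ℝ} (hK : ∀ (u : Circle) (h : SU11), f (rot u * h) = f h) (g : SU11)
    (hint : Integrable (Function.uncurry fun (u : Circle) (h : SU11) =>
      f h * sph lam (h⁻¹ * (rot u)⁻¹ * g)) (haarCircle.prod μ)) :
    ∫ h, f h * sph lam (h⁻¹ * g) ∂μ = (∫ h, f h * sph lam h ∂μ) * sph lam g := by
  have step1 : ∀ u : Circle, ∫ h, f h * sph lam (h⁻¹ * g) ∂μ =
      ∫ h, f h * sph lam (h⁻¹ * (rot u)⁻¹ * g) ∂μ := by
    intro u
    rw [← integral_mul_left_eq_self (fun h => f h * sph lam (h⁻¹ * g)) (rot u)]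
    congr 1
    funext h
    rw [hK, mul_inv_rev, mul_assoc]
  have step2 : ∫ h, f h * sph lam (h⁻¹ * g) ∂μ =
      ∫ u, ∫ h, f h * sph lam (h⁻¹ * (rot u)⁻¹ * g) ∂μ ∂haarCircle := by
    rw [← integral_congr_ae (Filter.Eventually.of_forall step1), integral_const, measureReal_def,
      haarCircle_univ, ENNReal.toReal_one, one_smul]
  rw [step2, integral_integral_swap hint]
  have step4 : ∀ h : SU11, ∫ u, f h * sph lam (h⁻¹ * (rot u)⁻¹ * g) ∂haarCircle =
      f h * sph lam h * sph lam g := by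
    intro h
    rw [integral_const_mul]
    have e : (fun u : Circle => sph lam (h⁻¹ * (rot u)⁻¹ * g)) =
        fun u : Circle => sph lam (h⁻¹ * rot u⁻¹ * g) := by
      funext u
      rw [map_inv]
    rw [e, integral_inv_eq_self (fun u : Circle => sph lam (h⁻¹ * rot u * g)) haarCircle,
      integral_sph_mul_rot_mul, sph_inv, mul_assoc]
  simp_rw [step4]
  rw [integral_mul_const]

/-- **A bound on `φ_λ(h⁻¹ k⁻¹ g)` over `K × tsupport f`** for compactly supported `f`. -/
lemma exists_bound_sph_on_support (lam : ℝ) (g : SU11) {f : SU11 → ℝ} (hfc : HasCompactSupport f) :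
    ∃ C : ℝ, ∀ (u : Circle) (h : SU11), h ∈ tsupport f →
      |sph lam (h⁻¹ * (rot u)⁻¹ * g)| ≤ C := by
  obtain ⟨C, hC⟩ := (isCompact_univ.prod hfc).exists_bound_of_continuousOn
    (continuous_sph_inv_mul_rot_inv lam g).continuousOn
  refine ⟨C, fun u h hh => ?_⟩
  have := hC (u, h) ⟨mem_univ _, hh⟩
  rwa [Real.norm_eq_abs] at this

/-- **The spherical transform on `C_c(K∖G)`, every `λ ∈ ℝ`**: for a Haar measure `μ` and a
continuous compactly supported left-`K`-invariant `f`,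
`∫_G f(h) · sph λ (h⁻¹ g) dμ(h) = (∫_G f(h) · sph λ h dμ(h)) · sph λ g`. -/
theorem integral_mul_sph_inv_mul_of_hasCompactSupport (μ : Measure SU11) [IsHaarMeasure μ]
    (lam : ℝ) {f : SU11 → ℝ} (hf : Continuous f) (hfc : HasCompactSupport f)
    (hK : ∀ (u : Circle) (h : SU11), f (rot u * h) = f h) (g : SU11) :
    ∫ h, f h * sph lam (h⁻¹ * g) ∂μ = (∫ h, f h * sph lam h ∂μ) * sph lam g := by
  refine integral_mul_sph_inv_mul_of_integrable μ lam hK g ?_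
  obtain ⟨C, hC⟩ := exists_bound_sph_on_support lam g hfc
  have hfi : Integrable f μ := hf.integrable_of_hasCompactSupport hfc
  refine Integrable.mono' (g := fun p : Circle × SU11 => C * |f p.2|)
    (((hfi.norm).comp_snd haarCircle).const_mul C) ?_ (Filter.Eventually.of_forall fun p => ?_)
  · exact ((hf.comp continuous_snd).mul (continuous_sph_inv_mul_rot_inv lam g)).aestronglyMeasurable
  · rw [Function.uncurry_apply_pair, Real.norm_eq_abs, abs_mul]
    by_cases hp : p.2 ∈ tsupport f
    · calc |f p.2| * |sph lam (p.2⁻¹ * (rot p.1)⁻¹ * g)| ≤ |f p.2| * C :=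
            mul_le_mul_of_nonneg_left (hC p.1 p.2 hp) (abs_nonneg _)
        _ = C * |f p.2| := mul_comm _ _
    · rw [image_eq_zero_of_notMem_tsupport hp, abs_zero, zero_mul, mul_zero]

end measure

end Summit.Ventures.HodgeRepro2.T5SU11SphericalTransformCc
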